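import Summits.Ventures.PercRepro2.CaseOneStarCfQt21
import Summits.Ventures.PercRepro2.CaseOneStarCfQt21Mono

/-!
# The marked star: the Bernstein coefficients of `cfQt21` as combinations of the monomial coefficients (part A)
(blind cell PercRepro2, p1 g18; S5 §2.1 (K9) (q); OPS l.38 (i) — RULING (F) 2026-08-25T23:42:22Z)

The `(r, s)`-Bernstein coefficients `cBQt21kl` of CaseOneStarCfQt21.lean are integer combinations of the monomial
coefficients `aQt21ij` (CaseOneStarCfQt21Mono.lean): `cBQt21kl = Σ_{i ≤ k, j ≤ l} c(k,i) c(l,j) aQt21ij` with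
`c(k,i) = 3 · C(k,i) / C(3,i)` (`cBQt21kl_eq`); for the index pairs without a Bernstein coefficient the combination
vanishes (`aQt21vkl`). With the monomial expansion `cfQt21_mono` the Bernstein identity `cfQt21_bern'` — the SAME
statement as `cfQt21_bern` — is a linear identity in `r`, `s` and the atoms `aQt21ij m`; every step elaborates
on a referee node (the cell identities are spread over modules so that each file stays small in kernel memory). -/

namespace Summit.Ventures.PercRepro2

namespace CaseOne

section CfQt21SplitA
variable {R : Type*} [CommRing R]

set_option maxHeartbeats 0 in
/-- `cBQt2100` as an integer combination of the monomial coefficients. -/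
theorem cBQt2100_eq (m : SCells R) :
    cBQt2100 m = (9 : R) * aQt2100 m := by
  unfold cBQt2100 aQt2100
  ring

set_option maxHeartbeats 0 in
/-- `cBQt2101` as an integer combination of the monomial coefficients. -/
theorem cBQt2101_eq (m : SCells R) :
    cBQt2101 m = (9 : R) * aQt2100 m + (3 : R) * aQt2101 m := by
  unfold cBQt2101 aQt2100 aQt2101
  ring

set_option maxHeartbeats 0 in
/-- `cBQt2102` as an integer combination of the monomial coefficients. -/
theorem cBQt2102_eq (m : SCells R) :
    cBQt2102 m = (9 : R) * aQt2100 m + (6 : R) * aQt2101 m + (3 : R) * aQt2102 m := by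
  unfold cBQt2102 aQt2100 aQt2101 aQt2102
  ring

set_option maxHeartbeats 0 in
/-- `cBQt2103` as an integer combination of the monomial coefficients. -/
theorem cBQt2103_eq (m : SCells R) :
    cBQt2103 m = (9 : R) * aQt2100 m + (9 : R) * aQt2101 m + (9 : R) * aQt2102 m + (9 : R) * aQt2103 m := by
  unfold cBQt2103 aQt2100 aQt2101 aQt2102 aQt2103
  ring

set_option maxHeartbeats 0 in
/-- `cBQt2110` as an integer combination of the monomial coefficients. -/
theorem cBQt2110_eq (m : SCells R) :
    cBQt2110 m = (9 : R) * aQt2100 m + (3 : R) * aQt2110 m := by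
  unfold cBQt2110 aQt2100 aQt2110
  ring

set_option maxHeartbeats 0 in
/-- `cBQt2111` as an integer combination of the monomial coefficients. -/
theorem cBQt2111_eq (m : SCells R) :
    cBQt2111 m = (9 : R) * aQt2100 m + (3 : R) * aQt2101 m + (3 : R) * aQt2110 m + (1 : R) * aQt2111 m := by
  unfold cBQt2111 aQt2100 aQt2101 aQt2110 aQt2111
  ring

set_option maxHeartbeats 0 in
/-- `cBQt2112` as an integer combination of the monomial coefficients. -/
theorem cBQt2112_eq (m : SCells R) :
    cBQt2112 m = (9 : R) * aQt2100 m + (6 : R) * aQt2101 m + (3 : R) * aQt2102 m + (3 : R) * aQt2110 m + (2 : R) * aQt2111 m + (1 : R) * aQt2112 m := by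
  unfold cBQt2112 aQt2100 aQt2101 aQt2102 aQt2110 aQt2111 aQt2112
  ring

set_option maxHeartbeats 0 in
/-- `cBQt2113` as an integer combination of the monomial coefficients. -/
theorem cBQt2113_eq (m : SCells R) :
    cBQt2113 m = (9 : R) * aQt2100 m + (9 : R) * aQt2101 m + (9 : R) * aQt2102 m + (9 : R) * aQt2103 m + (3 : R) * aQt2110 m + (3 : R) * aQt2111 m + (3 : R) * aQt2112 m + (3 : R) * aQt2113 m := by
  unfold cBQt2113 aQt2100 aQt2101 aQt2102 aQt2103 aQt2110 aQt2111 aQt2112 aQt2113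
  ring


end CfQt21SplitA

end CaseOne

end Summit.Ventures.PercRepro2
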